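import Summits.AtomisticToContinuum.Crystallization.Theorems.ChargedEnergyGapLocalTransferA
import HarnessLib

/-!
# «LocalisedTransfer» (lens-3 g56 P-D, line 14231) — part B (sequel of `…ChargedEnergyGapLocalTransferA`)
LANDING BANNER (critic row 1115 (6); landing lane hand-2 g31): the (H𝄪)/(N𝄪)-type RECORD pieces of this lens-3 g53–g56 engine are VACUOUS at μ₀ > 0 — `harmStableWith_nonpos` (lens-3 g61, `…ChargedEnergyGapRotationGauge`); superseded by the …R designate ((H𝄪ʳ) `LocalSeamTransferBoundR`, (N𝄪ʳ) `LocalSeamReductionR` of `…ChargedEnergyGapRotationRepair`).  Landed as an ENGINE: the transfer / reduction lemmas below are consumed by P-I.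

Split for the 400-line cap by the landing lane (hand-2 g29); the module docstring of part A describes the whole node.  Same namespace; all FQNs unchanged.
0 sorry; standard axioms.
-/

noncomputable section
open scoped Classical
open Literature.MathematicalPhysics.StatisticalMechanics
open Literature.Geometry.DiscreteGeometry
open Summit.AtomisticToContinuum.Crystallization.Theses.PricedLinkCensus
open Summit.AtomisticToContinuum.Crystallization.Theorems.ChargedEnergyGapNegative

namespace Summit.AtomisticToContinuum.Crystallization.Theorems.ChargedEnergyGapChartDial

/-! ## §2 The two pieces, (H𝄪) ⟹ (Hˢ) ⟹ (H♯) ⟹ (H♭) ⟹ (H), (Nˢ) ⟹ (N𝄪), glue, WEAKER, dials -/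

section Pieces

variable (s lam ℓ μ₀ τ lamQ ϱ b₀ r_S C_T ϱχ Cχ : ℝ)

/-- piece LOCAL-TRANSFER(`C_T`, `Cχ`, `ϱχ`) · STRONGER than SEAM-TRANSFER (`seamTransferBoundC_of_local`, the empty list), hence than
VOLTERRA-TRANSFER (`b₀ ≤ s`), HARM-TRANSFER♭, (H) · UNDECIDED→TRUE-leaning at the record · INSTRUMENTABLE (census ask χCOST-56: the C11 engine
at transition width `ϱχ/2 = 40`; C15/C16 (b) inherited through (Hˢ)) · ATTACKABLE-M+.  **THE LOCALISED SEAM TRANSFER BOUND**: some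
`C_H ≥ 0` such that for every reference, centre set, excised set, global cocycle and seam system admissible in (Hˢ), and every finite list
of `Λ_P`-INVARIANT sets `D : Fin m → Set E3` with sign pattern `σ`, the harmonic model of the far account with the weights `χ·w`
(`χ = localFactor ϱχ D σ`) on the Volterra field is at least `−C_T·(χ-weighted shell mass) − Cχ·(w-weighted alive transition mass × mult²)
− C_H·(localised near-priced excised count)`.  Why it might fail: everything that threatens (Hˢ), PLUS (i) the third-moment cost of a
χ-transition of width `ϱχ/2` exceeding `Cχ` per unit `w` (table: `c(40) = 2.5–5.3·10⁻⁶` against `Cχ = 10⁻⁵`, margin `×1.9–×4` only —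
census ask χCOST-56 decides; at `ϱχ = 50` the margin would be gone), (ii) cross terms of `∇w ⊗ ∇²χ` type inside the w-shell where both vary (priced
by BOTH masses there; AM–GM), (iii) a listed set that is not `Λ_P`-invariant (excluded: hypothesis) or `ϱχ` so small that the factors are
site-scale indicators (the dial, not the statement: at the record `ϱχ = 80`).  At `m = 0` it is (Hˢ). -/
def LocalSeamTransferBoundC : Prop :=
  ∃ C_H : ℝ, 0 ≤ C_H ∧ ∀ (P : PeriodicConfiguration 3) (C X : Set E3) (β₀ : E3 → E3 → E3) (k : ℕ) (S : Fin k → CutPiece)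
    (m : ℕ) (D : Fin m → Set E3) (σ : Fin m → Bool),
    IsSeparatedRef s P → IsLabelledRef lam ℓ P → IsForceFree P → IsStressFree P → HarmStableWith μ₀ P →
    IsInvariantSet P C → IsInvariantSet P X → IsGlobalCocycle P β₀ → IsSeamSystem b₀ r_S P S →
    SmallStrain τ P X (volterraField P S β₀) → (∀ i, IsInvariantSet P (D i)) →
      -(C_T * shellMassL ϱχ D σ P X ϱ C) - Cχ * transMassL ϱχ D σ P X ϱ C - C_H * (pricedNearCountL ϱχ D σ P X ϱ C : ℝ) ≤
        modelFarL ϱχ D σ (volterraField P S β₀) P X lamQ ϱ C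

variable {s lam ℓ μ₀ τ lamQ ϱ b₀ r_S C_T ϱχ Cχ}

/-- ★ **(H𝄪) ⟹ (Hˢ)**: the localised bound at the EMPTY list is the seam transfer bound verbatim. -/
theorem seamTransferBoundC_of_local (h : LocalSeamTransferBoundC s lam ℓ μ₀ τ lamQ ϱ b₀ r_S C_T ϱχ Cχ) :
    SeamTransferBoundC s lam ℓ μ₀ τ lamQ ϱ b₀ r_S C_T := by
  obtain ⟨C_H, hH, h⟩ := h
  refine ⟨C_H, hH, fun P C X β₀ k S h1 h2 h3 h4 h5 h6 h7 h8 h9 h10 => ?_⟩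
  have key := h P C X β₀ k S 0 Fin.elim0 Fin.elim0 h1 h2 h3 h4 h5 h6 h7 h8 h9 h10 fun i => i.elim0
  rw [shellMassL_fin_zero, transMassL_fin_zero, pricedNearCountL_fin_zero, modelFarL_fin_zero] at key
  simp only [mul_zero, sub_zero] at key
  exact key

/-- Hence **(H𝄪) ⟹ (H♯)** for `b₀ ≤ s` … -/
theorem volterraTransferBoundC_of_local (hb : b₀ ≤ s) (h : LocalSeamTransferBoundC s lam ℓ μ₀ τ lamQ ϱ b₀ r_S C_T ϱχ Cχ) :
    VolterraTransferBoundC s lam ℓ μ₀ τ lamQ ϱ r_S C_T :=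
  volterraTransferBoundC_of_seam hb (seamTransferBoundC_of_local h)

/-- … **(H𝄪) ⟹ (H♭)** at every floor … -/
theorem harmonicTransferBoundC_of_local (h : LocalSeamTransferBoundC s lam ℓ μ₀ τ lamQ ϱ b₀ r_S C_T ϱχ Cχ) :
    HarmonicTransferBoundC s lam ℓ μ₀ τ lamQ ϱ C_T :=
  harmonicTransferBoundC_of_seam (seamTransferBoundC_of_local h)

/-- … and **(H𝄪) ⟹ (H)**, the census kill path of record: a refutation of (H) (C10/C11/C13/C15) refutes (H𝄪). -/
theorem harmonicTransferBound_of_local (h : LocalSeamTransferBoundC s lam ℓ μ₀ τ lamQ ϱ b₀ r_S C_T ϱχ Cχ) :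
    HarmonicTransferBound s lam ℓ μ₀ τ lamQ ϱ C_T :=
  harmonicTransferBound_of_seam (seamTransferBoundC_of_local h)

variable (s lam ℓ μ₀ τ lamQ ϱ b₀ r_S C_T ϱχ Cχ)
variable {θ ε R r η L δ L' : ℝ} (W : CoreWeights θ ε R r η L δ L' ϱ) (c₁ ρ₀ B₀ : ℝ)

/-- piece LOCAL-REDUCTION_W · WEAKER than SEAM-REDUCTION_W (`localSeamReductionW_of_seamReduction`), than VOLTERRA-REDUCTION_W (`b₀ ≤ s`),
HARM-REDUCTION_W and CB-FAR_W|cored,`B₀` (`localSeamReductionW_of_budget`) · UNDECIDED (TRUE-leaning with the leaf for the max cover) ·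
ATTACKABLE-L on EVERY clean labelled far component of a Barlow TWIN NETWORK of any generation structure — memo g56 §4: listed sets = the
carved orientation classes `D_O = (class-O matter) ∩ {w > 0}`; instances = the MIN-ASSIGNMENT patterns `n_O·∏_{U<O} f_U` («near `O`, far
from every earlier class»), a partition of unity; instance `O` is charted over the reference of orientation `O` with the first-generation
seams of (Nˢ) — admissible because every alive pattern at a weighted site `> R₁` from other-gross matter has all its classes within one
twin step of each of them (WEDGE-CROSSING LEMMA ⇐ EDGE LEMMA ⇐ Σ3ⁿ tree + census ask GROSS-56), and the transition zone `(40, 80)` of a class stays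
`≥ 12` clear of every class not served (proximity `160/√3 = 92.4`); everything farther than `3ϱ/8 = 60` from the instance's support is
excised free; payers: the GLOBAL layer surplus `3.63·10⁻⁵·w` per site and staggered side (zones cost `2Cχ·w`), the debit near other-gross matter,
`w = 0` near cores, and at polyhedral cell corners the min-assignment price `P(m) ∈ {0, 2, 9, 23, 46}·Cχ·w` (core slack `c₁/3` of the
cored edge; random class order: mean `11/3·Cχ` at
dihedral corners; vertex excess on the core slack `c₁/3`); stacking seams, ribbons, centred dislocations and priced holes as in (Nˢ) ·
residual (ε) charted-charged coherent misoriented walls (census C16 (d)); physical inputs χCOST-56, GROSS-56.  **THE LOCALISED SEAM REDUCTION**: the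
localised seam transfer bound implies the budget far leaf.  Why it might fail: only with the leaf (implied by it) — as a PROOF TASK it is
open on (ε), on the c-fraction of transition zones in heavily faulted matter (`≥ 0.28` needed locally, else the global surplus), and on
the formalisation of the orientation-class geometry (edge lemma, wedge crossing) over `LabelledWithin`. -/
def LocalSeamReductionW : Prop :=
  LocalSeamTransferBoundC s lam ℓ μ₀ τ lamQ ϱ b₀ r_S C_T ϱχ Cχ → FarLabelledFloorCoredBudgetW W c₁ s ρ₀ lam ℓ B₀

variable {s lam ℓ μ₀ τ lamQ ϱ b₀ r_S C_T ϱχ Cχ W c₁ ρ₀ B₀}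

/-- ★ **THE SPLIT** (glue, proved; bridge split by modus ponens): LOCAL-TRANSFER ∧ LOCAL-REDUCTION_W ⟹ CB-FAR_W|cored,`B₀`. -/
theorem farLabelledFloorCoredBudgetW_of_local (hS : LocalSeamTransferBoundC s lam ℓ μ₀ τ lamQ ϱ b₀ r_S C_T ϱχ Cχ)
    (hN : LocalSeamReductionW s lam ℓ μ₀ τ lamQ ϱ b₀ r_S C_T ϱχ Cχ W c₁ ρ₀ B₀) : FarLabelledFloorCoredBudgetW W c₁ s ρ₀ lam ℓ B₀ :=
  hN hS

/-- ★ WEAKER: SEAM-REDUCTION_W ⟹ LOCAL-REDUCTION_W (the reduction got easier: its hypothesis got stronger). -/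
theorem localSeamReductionW_of_seamReduction (h : SeamReductionW s lam ℓ μ₀ τ lamQ ϱ b₀ r_S C_T W c₁ ρ₀ B₀) :
    LocalSeamReductionW s lam ℓ μ₀ τ lamQ ϱ b₀ r_S C_T ϱχ Cχ W c₁ ρ₀ B₀ :=
  fun hS => h (seamTransferBoundC_of_local hS)

/-- WEAKER: VOLTERRA-REDUCTION_W ⟹ LOCAL-REDUCTION_W for `b₀ ≤ s`. -/
theorem localSeamReductionW_of_volterraReduction (hb : b₀ ≤ s) (h : VolterraReductionW s lam ℓ μ₀ τ lamQ ϱ r_S C_T W c₁ ρ₀ B₀) :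
    LocalSeamReductionW s lam ℓ μ₀ τ lamQ ϱ b₀ r_S C_T ϱχ Cχ W c₁ ρ₀ B₀ :=
  fun hS => h (volterraTransferBoundC_of_local hb hS)

/-- WEAKER: HARM-REDUCTION_W ⟹ LOCAL-REDUCTION_W. -/
theorem localSeamReductionW_of_harmonicReduction (h : HarmonicReductionW s lam ℓ μ₀ τ lamQ ϱ C_T W c₁ ρ₀ B₀) :
    LocalSeamReductionW s lam ℓ μ₀ τ lamQ ϱ b₀ r_S C_T ϱχ Cχ W c₁ ρ₀ B₀ :=
  fun hS => h (harmonicTransferBoundC_of_local hS)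

/-- WEAKER: the budget far leaf implies LOCAL-REDUCTION_W at every dial. -/
theorem localSeamReductionW_of_budget (h : FarLabelledFloorCoredBudgetW W c₁ s ρ₀ lam ℓ B₀) :
    LocalSeamReductionW s lam ℓ μ₀ τ lamQ ϱ b₀ r_S C_T ϱχ Cχ W c₁ ρ₀ B₀ :=
  fun _ => h

/-- The five-generation chain in one line: SHELL-BUDGET_W ∧ LOCAL-TRANSFER ∧ LOCAL-REDUCTION_W ⟹ CB-FAR_W|cored (parts O-D, P-A … P-D). -/
theorem farLabelledFloorCoredW_of_local_shellBudget (hB : ShellBudgetW W s B₀)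
    (hS : LocalSeamTransferBoundC s lam ℓ μ₀ τ lamQ ϱ b₀ r_S C_T ϱχ Cχ)
    (hN : LocalSeamReductionW s lam ℓ μ₀ τ lamQ ϱ b₀ r_S C_T ϱχ Cχ W c₁ ρ₀ B₀) : FarLabelledFloorCoredW W c₁ s ρ₀ lam ℓ :=
  farLabelledFloorCoredW_of_shellBudget W hB (farLabelledFloorCoredBudgetW_of_local hS hN)

/-- LOCAL-TRANSFER is monotone in the transfer constant `C_T` … -/
theorem LocalSeamTransferBoundC.mono_CT {C_T' : ℝ} (hC : C_T ≤ C_T') (h : LocalSeamTransferBoundC s lam ℓ μ₀ τ lamQ ϱ b₀ r_S C_T ϱχ Cχ) :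
    LocalSeamTransferBoundC s lam ℓ μ₀ τ lamQ ϱ b₀ r_S C_T' ϱχ Cχ := by
  obtain ⟨C_H, hH, h⟩ := h
  refine ⟨C_H, hH, fun P C X β₀ k S m D σ h1 h2 h3 h4 h5 h6 h7 h8 h9 h10 h11 => ?_⟩
  have key := h P C X β₀ k S m D σ h1 h2 h3 h4 h5 h6 h7 h8 h9 h10 h11
  have hm : C_T * shellMassL ϱχ D σ P X ϱ C ≤ C_T' * shellMassL ϱχ D σ P X ϱ C :=
    mul_le_mul_of_nonneg_right hC (shellMassL_nonneg _ _ _ _ _ _ _)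
  linarith

/-- … monotone in the transition constant `Cχ` (the new dial; the safe direction is UP) … -/
theorem LocalSeamTransferBoundC.mono_Cchi {Cχ' : ℝ} (hC : Cχ ≤ Cχ') (h : LocalSeamTransferBoundC s lam ℓ μ₀ τ lamQ ϱ b₀ r_S C_T ϱχ Cχ) :
    LocalSeamTransferBoundC s lam ℓ μ₀ τ lamQ ϱ b₀ r_S C_T ϱχ Cχ' := by
  obtain ⟨C_H, hH, h⟩ := h
  refine ⟨C_H, hH, fun P C X β₀ k S m D σ h1 h2 h3 h4 h5 h6 h7 h8 h9 h10 h11 => ?_⟩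
  have key := h P C X β₀ k S m D σ h1 h2 h3 h4 h5 h6 h7 h8 h9 h10 h11
  have hm : Cχ * transMassL ϱχ D σ P X ϱ C ≤ Cχ' * transMassL ϱχ D σ P X ϱ C :=
    mul_le_mul_of_nonneg_right hC (transMassL_nonneg _ _ _ _ _ _ _)
  linarith

/-- … antitone in the strain amplitude `τ` (fewer test data) … -/
theorem LocalSeamTransferBoundC.anti_tau {τ' : ℝ} (hτ : τ' ≤ τ) (h : LocalSeamTransferBoundC s lam ℓ μ₀ τ lamQ ϱ b₀ r_S C_T ϱχ Cχ) :
    LocalSeamTransferBoundC s lam ℓ μ₀ τ' lamQ ϱ b₀ r_S C_T ϱχ Cχ := by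
  obtain ⟨C_H, hH, h⟩ := h
  refine ⟨C_H, hH, fun P C X β₀ k S m D σ h1 h2 h3 h4 h5 h6 h7 h8 h9 h10 h11 =>
    h P C X β₀ k S m D σ h1 h2 h3 h4 h5 h6 h7 h8 h9 ?_ h11⟩
  intro y hy z hz hyX hzX
  exact (h10 y hy z hz hyX hzX).trans (mul_le_mul_of_nonneg_right hτ dist_nonneg)

/-- … monotone in the stability margin `μ₀` (fewer references) … -/
theorem LocalSeamTransferBoundC.mono_mu {μ₀' : ℝ} (hμ : μ₀ ≤ μ₀') (h : LocalSeamTransferBoundC s lam ℓ μ₀ τ lamQ ϱ b₀ r_S C_T ϱχ Cχ) :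
    LocalSeamTransferBoundC s lam ℓ μ₀' τ lamQ ϱ b₀ r_S C_T ϱχ Cχ := by
  obtain ⟨C_H, hH, h⟩ := h
  refine ⟨C_H, hH, fun P C X β₀ k S m D σ h1 h2 h3 h4 h5 h6 h7 h8 h9 h10 h11 =>
    h P C X β₀ k S m D σ h1 h2 h3 h4 ?_ h6 h7 h8 h9 h10 h11⟩
  intro γ hγ
  have h0 : 0 ≤ ∑ y ∈ P.motif, dirichletSite γ P y :=
    Finset.sum_nonneg fun y _ => tsum_nonneg fun _ => sq_nonneg _
  exact (mul_le_mul_of_nonneg_right hμ h0).trans (h5 γ hγ)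

/-- … monotone in the separation `s` (fewer references) … -/
theorem LocalSeamTransferBoundC.mono_s {s' : ℝ} (hs : s ≤ s') (h : LocalSeamTransferBoundC s lam ℓ μ₀ τ lamQ ϱ b₀ r_S C_T ϱχ Cχ) :
    LocalSeamTransferBoundC s' lam ℓ μ₀ τ lamQ ϱ b₀ r_S C_T ϱχ Cχ := by
  obtain ⟨C_H, hH, h⟩ := h
  exact ⟨C_H, hH, fun P C X β₀ k S m D σ h1 h2 h3 h4 h5 h6 h7 h8 h9 h10 h11 =>
    h P C X β₀ k S m D σ (fun y hy z hz hne => hs.trans (h1 y hy z hz hne)) h2 h3 h4 h5 h6 h7 h8 h9 h10 h11⟩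

/-- … antitone in the labelling tolerance `lam` of the reference (fewer references) … -/
theorem LocalSeamTransferBoundC.anti_lam {lam' : ℝ} (hlam : lam' ≤ lam)
    (h : LocalSeamTransferBoundC s lam ℓ μ₀ τ lamQ ϱ b₀ r_S C_T ϱχ Cχ) :
    LocalSeamTransferBoundC s lam' ℓ μ₀ τ lamQ ϱ b₀ r_S C_T ϱχ Cχ := by
  obtain ⟨C_H, hH, h⟩ := h
  exact ⟨C_H, hH, fun P C X β₀ k S m D σ h1 h2 h3 h4 h5 h6 h7 h8 h9 h10 h11 =>
    h P C X β₀ k S m D σ h1 (fun y hy => (h2 y hy).mono hlam) h3 h4 h5 h6 h7 h8 h9 h10 h11⟩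

/-- … monotone in the in-radius threshold `r_S` (fewer seam systems) … -/
theorem LocalSeamTransferBoundC.mono_rS {r_S' : ℝ} (hr : r_S ≤ r_S') (h : LocalSeamTransferBoundC s lam ℓ μ₀ τ lamQ ϱ b₀ r_S C_T ϱχ Cχ) :
    LocalSeamTransferBoundC s lam ℓ μ₀ τ lamQ ϱ b₀ r_S' C_T ϱχ Cχ := by
  obtain ⟨C_H, hH, h⟩ := h
  exact ⟨C_H, hH, fun P C X β₀ k S m D σ h1 h2 h3 h4 h5 h6 h7 h8 h9 h10 h11 =>
    h P C X β₀ k S m D σ h1 h2 h3 h4 h5 h6 h7 h8 (h9.anti hr) h10 h11⟩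

/-- … and monotone in the floor `b₀` (fewer seam systems). -/
theorem LocalSeamTransferBoundC.mono_b0 {b₀' : ℝ} (hb : b₀ ≤ b₀') (h : LocalSeamTransferBoundC s lam ℓ μ₀ τ lamQ ϱ b₀ r_S C_T ϱχ Cχ) :
    LocalSeamTransferBoundC s lam ℓ μ₀ τ lamQ ϱ b₀' r_S C_T ϱχ Cχ := by
  obtain ⟨C_H, hH, h⟩ := h
  exact ⟨C_H, hH, fun P C X β₀ k S m D σ h1 h2 h3 h4 h5 h6 h7 h8 h9 h10 h11 =>
    h P C X β₀ k S m D σ h1 h2 h3 h4 h5 h6 h7 h8 (h9.anti_floor hb) h10 h11⟩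

/-- LOCAL-REDUCTION_W is antitone in `C_T` … -/
theorem LocalSeamReductionW.anti_CT {C_T' : ℝ} (hC : C_T' ≤ C_T)
    (h : LocalSeamReductionW s lam ℓ μ₀ τ lamQ ϱ b₀ r_S C_T ϱχ Cχ W c₁ ρ₀ B₀) :
    LocalSeamReductionW s lam ℓ μ₀ τ lamQ ϱ b₀ r_S C_T' ϱχ Cχ W c₁ ρ₀ B₀ :=
  fun hS => h (hS.mono_CT hC)

/-- … antitone in `Cχ` (a reduction may price its transitions higher when the transfer bound lets it) … -/
theorem LocalSeamReductionW.anti_Cchi {Cχ' : ℝ} (hC : Cχ' ≤ Cχ)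
    (h : LocalSeamReductionW s lam ℓ μ₀ τ lamQ ϱ b₀ r_S C_T ϱχ Cχ W c₁ ρ₀ B₀) :
    LocalSeamReductionW s lam ℓ μ₀ τ lamQ ϱ b₀ r_S C_T ϱχ Cχ' W c₁ ρ₀ B₀ :=
  fun hS => h (hS.mono_Cchi hC)

/-- … monotone in the strain amplitude `τ` … -/
theorem LocalSeamReductionW.mono_tau {τ' : ℝ} (hτ : τ ≤ τ')
    (h : LocalSeamReductionW s lam ℓ μ₀ τ lamQ ϱ b₀ r_S C_T ϱχ Cχ W c₁ ρ₀ B₀) :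
    LocalSeamReductionW s lam ℓ μ₀ τ' lamQ ϱ b₀ r_S C_T ϱχ Cχ W c₁ ρ₀ B₀ :=
  fun hS => h (hS.anti_tau hτ)

/-- … antitone in the stability margin `μ₀` … -/
theorem LocalSeamReductionW.anti_mu {μ₀' : ℝ} (hμ : μ₀' ≤ μ₀)
    (h : LocalSeamReductionW s lam ℓ μ₀ τ lamQ ϱ b₀ r_S C_T ϱχ Cχ W c₁ ρ₀ B₀) :
    LocalSeamReductionW s lam ℓ μ₀' τ lamQ ϱ b₀ r_S C_T ϱχ Cχ W c₁ ρ₀ B₀ :=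
  fun hS => h (hS.mono_mu hμ)

/-- … antitone in the in-radius threshold `r_S` … -/
theorem LocalSeamReductionW.anti_rS {r_S' : ℝ} (hr : r_S' ≤ r_S)
    (h : LocalSeamReductionW s lam ℓ μ₀ τ lamQ ϱ b₀ r_S C_T ϱχ Cχ W c₁ ρ₀ B₀) :
    LocalSeamReductionW s lam ℓ μ₀ τ lamQ ϱ b₀ r_S' C_T ϱχ Cχ W c₁ ρ₀ B₀ :=
  fun hS => h (hS.mono_rS hr)

/-- … antitone in the floor `b₀` … -/
theorem LocalSeamReductionW.anti_b0 {b₀' : ℝ} (hb : b₀' ≤ b₀)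
    (h : LocalSeamReductionW s lam ℓ μ₀ τ lamQ ϱ b₀ r_S C_T ϱχ Cχ W c₁ ρ₀ B₀) :
    LocalSeamReductionW s lam ℓ μ₀ τ lamQ ϱ b₀' r_S C_T ϱχ Cχ W c₁ ρ₀ B₀ :=
  fun hS => h (hS.mono_b0 hb)

/-- … monotone in the slack `c₁` and antitone in the budget `B₀` (inherited from the leaf). -/
theorem LocalSeamReductionW.mono_c {c₁' B₀' : ℝ} (hc : c₁ ≤ c₁') (hB : B₀' ≤ B₀)
    (h : LocalSeamReductionW s lam ℓ μ₀ τ lamQ ϱ b₀ r_S C_T ϱχ Cχ W c₁ ρ₀ B₀) :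
    LocalSeamReductionW s lam ℓ μ₀ τ lamQ ϱ b₀ r_S C_T ϱχ Cχ W c₁' ρ₀ B₀' :=
  fun hS => ((h hS).mono W hc).anti W hB

end Pieces

/-! ## §3 The record dials `(ϱχ, Cχ) = (80, 10⁻⁵)` over `(μ₀, τ, λ, b₀, r_S, C_T)` of P-C, the budget table, ★★ the ten-leaf cones -/

section Record

/-- The record localisation scale is half the record profile scale: χ-transitions (`ϱχ/2 = 40` wide, between `40` and `80` from a listed
set) are half as wide as the w-shell (`80` to `160` from the centre set). -/
theorem record_local_scale : (80 : ℝ) = 160 / 2 ∧ (80 : ℝ) / 2 = 40 := by norm_num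

/-- (L1) Budget table, row `L = 40`, measured calibration: `16×` (third-moment law `L⁻⁴` at half the width) the per-shell-site optimum of
census C11-29 at `λ = 1/2` (`2·7.8·10⁻⁸`) stays below the record transition constant `Cχ = 10⁻⁵` (margin `×4`). -/
theorem record_local_cost_measured : 16 * (2 * (78 / 1000000000 : ℝ)) < 1 / 100000 := by norm_num

/-- (L1) Budget table, row `L = 40`, budgeted calibration: `16·C_T = 16/(3·10⁶) < Cχ` (margin `×1.9`). -/
theorem record_local_cost_budgeted : 16 * (1 / 3000000 : ℝ) < 1 / 100000 := by norm_num

/-- (L1) Self-paying width: at transition width `25` the budgeted law `C_T·(80/L)⁴` is still below the one-sided layer surplus `3.63·10⁻⁵`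
(threshold `L₀ ≈ 24.8`; the record width `40` has slack `×6.8`). -/
theorem record_self_paying_width : (80 / 25 : ℝ) ^ 4 * (1 / 3000000) < 363 / 10000000 := by norm_num

/-- (L1) Payability of a simple transition zone: the two patterns sharing it pay `2Cχ·w`, below the ONE-SIDED layer surplus `3.63·10⁻⁵·w`
(a layer next to a twin plane or a fault: one staggered second-neighbour side; converged layer table, census C16-31 (c), critic row 1067;
margin `×1.8`) and below the fcc-interior surplus `b₂ = 7.27·10⁻⁵·w` (two staggered sides; margin `×3.6`). -/
theorem record_local_payable : 2 * (1 / 100000 : ℝ) < 363 / 10000000 ∧ 2 * (1 / 100000 : ℝ) < 727 / 10000000 := by norm_num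

/-- (L1) Dihedral corners of twin cells (`70.5°` edges only; mult-2 sites out to `139` from the cored edge, `w ≤ 0.66`; corner w-mass
`≤ 62.3` area units `≈ 68` site units per unit edge length with the tree's septic profile, memo §2): even the WORST min-assignment price
`P(2) = 9` in units `Cχ·w`, with no local surplus at all, is carried by the core slack `c₁/3 = 1/60` of `2/5` core sites per unit edge length. -/
theorem record_corner_core_slack : 9 * (1 / 100000 : ℝ) * 68 < 2 / 5 * (1 / 20 / 3) := by norm_num

/-- (L1) … and over random class orders the dihedral corner price `P(0), P(1), P(2) = 0, 2, 9` averages `11/3·Cχ`, below the fcc-interior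
surplus `7.27·10⁻⁵` that corner sites (`≥ 40` from both faces) carry in clean cells — informative; the core slack is the payer of record. -/
theorem record_corner_order : ((0 : ℝ) + 2 + 9) / 3 * (1 / 100000) < 727 / 10000000 := by norm_num

/-- ROW 1067 STANDING RULE (`R_c ≥ 20` or the converged layer table for every registry / fault number of line 14231): P-C's
`record_seam_margin` compared `τ·(3/1000)` with the sharp-`R_c = 8` ARTEFACT `γ_I2 = 2.786·10⁻⁴`; on the converged value
`γ_I2(LJ, R_c → ∞) = 1.78·10⁻⁴` (census C16-31) the margin is `×2.0` and the inequality stands.  None of the record dials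
`(μ₀, τ, λ, b₀, r_S, C_T) = (1/100, 3/100, 1/2, 2/5, 3, 1/(3·10⁶))` nor `(ϱχ, Cχ)` was derived from `γ_I2` or from an `R_c = 8` registry sum
(memo §1: `b₀`, `r_S` are lattice geometry; `τ`, `μ₀` core strain / phonon margins; `C_T`, `Cχ` harmonic transfer calibrations; `λ` the
labelling tolerance): nothing moves. -/
theorem record_seam_margin_converged : (3 : ℝ) / 100 * (3 / 1000) < 178 / 1000000 := by norm_num

/-- PROXIMITY numeral of the wedge-crossing lemma: two points `≥ 80` from the edge on the outer sides of a `70.53°` twin wedge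
(`cos = 1/3`, `sin² (α/2) = 1/3`) are `≥ 160/√3` apart, and `160/√3 ≥ ϱχ + 12` at the record — the transition zone `(40, 80)` around a
carved class stays `≥ 12` clear of every class two twin steps away. -/
theorem record_proximity : ((80 : ℝ) + 12) ^ 2 ≤ 160 ^ 2 / 3 := by norm_num

/-- FREE-EXCISION numeral (the critic's ASK «model pair range `< 3ϱ/8`»): the model's site sums range over NON-excised sites only, so an
excised site is absent from the model at every distance; on the true side a free excised site is `≥ 3ϱ/8 = 60` from every weighted site,
where the pair force is `|V′(r)| ≤ 24·r⁻⁷ ≤ 24/60⁷ < 10⁻¹¹` — free far excision is allowance-neutral at the record. -/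
theorem record_free_excision_tail : 3 * (160 : ℝ) / 8 = 60 ∧ (24 : ℝ) / 60 ^ 7 < 1 / 10 ^ 11 := by norm_num

/-- ★★ **THE TEN-LEAF RECORD CONE FOR EVERY WEIGHT SYSTEM**: `ChargeRecount · IP_G · FCP_G · CCP_G · REG-BALL_W · LABEL_W ·
SHELL-BUDGET_W(10⁵) · LOCAL-TRANSFER(1/(3·10⁶), 10⁻⁵, 80) · LOCAL-REDUCTION_W · P_G ⟹ ChargedEnergyGap` at the record dials, any `ϱ`, any `W`. -/
theorem chargedEnergyGap_of_localLedger {ϱ : ℝ} (W : CoreWeights (3 / 20) (1 / 10) (6 / 5) 10 (1 / 100) 40 (1 / 10) 40 ϱ)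
    (hF : ChargeRecount)
    (hIP : ImprovablePricingG (3 / 20) (1 / 10) (6 / 5) 10 (1 / 100) (3 / 5))
    (hFCP : FrustratedCorePricingG (3 / 20) (1 / 10) (6 / 5) 10 (1 / 100) 40 (3 / 5))
    (hCCP : CoherentCorePricingG (3 / 20) (1 / 10) (6 / 5) 10 (1 / 100) 40 (1 / 10) 40 (3 / 5))
    (hB : CoreBallRegularPricingW W (1 / 20) (3 / 5) 10 fun _ _ => True)
    (hLab : CleanLabellingW W (3 / 5) 10 (1 / 3) 3)
    (hSB : ShellBudgetW W (3 / 5) 100000)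
    (hS : LocalSeamTransferBoundC (3 / 5) (1 / 3) 3 (1 / 100) (3 / 100) (1 / 2) ϱ (2 / 5) 3 (1 / 3000000) 80 (1 / 100000))
    (hN : LocalSeamReductionW (3 / 5) (1 / 3) 3 (1 / 100) (3 / 100) (1 / 2) ϱ (2 / 5) 3 (1 / 3000000) 80 (1 / 100000) W (1 / 20) 10
      100000)
    (hP : ChartedChargePricingG (3 / 20) (1 / 10) (3 / 5)) : ChargedEnergyGap :=
  chargedEnergyGap_of_budgetLedger W hF hIP hFCP hCCP hB hLab hSB (farLabelledFloorCoredBudgetW_of_local hS hN) hP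

/-- ★★ **THE MAX-COVER TEN-LEAF RECORD CONE** at `ϱ = 160` (record-designate R1): `ChargeRecount · IP_G · FCP_G · CCP_G · REG-BALL_M ·
LABEL_M · SHELL-BUDGET_M(10⁵) · LOCAL-TRANSFER(1/(3·10⁶), 10⁻⁵, 80) · LOCAL-REDUCTION_M · P_G ⟹ ChargedEnergyGap`. -/
theorem chargedEnergyGap_of_maxCoverLocalLedger_record (hF : ChargeRecount)
    (hIP : ImprovablePricingG (3 / 20) (1 / 10) (6 / 5) 10 (1 / 100) (3 / 5))
    (hFCP : FrustratedCorePricingG (3 / 20) (1 / 10) (6 / 5) 10 (1 / 100) 40 (3 / 5))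
    (hCCP : CoherentCorePricingG (3 / 20) (1 / 10) (6 / 5) 10 (1 / 100) 40 (1 / 10) 40 (3 / 5))
    (hB : CoreBallRegularPricingW (maxCoverWeights (3 / 20) (1 / 10) (6 / 5) 10 (1 / 100) 40 (1 / 10) 40 160) (1 / 20) (3 / 5) 10
      fun _ _ => True)
    (hLab : CleanLabellingW (maxCoverWeights (3 / 20) (1 / 10) (6 / 5) 10 (1 / 100) 40 (1 / 10) 40 160) (3 / 5) 10 (1 / 3) 3)
    (hSB : ShellBudgetW (maxCoverWeights (3 / 20) (1 / 10) (6 / 5) 10 (1 / 100) 40 (1 / 10) 40 160) (3 / 5) 100000)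
    (hS : LocalSeamTransferBoundC (3 / 5) (1 / 3) 3 (1 / 100) (3 / 100) (1 / 2) 160 (2 / 5) 3 (1 / 3000000) 80 (1 / 100000))
    (hN : LocalSeamReductionW (3 / 5) (1 / 3) 3 (1 / 100) (3 / 100) (1 / 2) 160 (2 / 5) 3 (1 / 3000000) 80 (1 / 100000)
      (maxCoverWeights (3 / 20) (1 / 10) (6 / 5) 10 (1 / 100) 40 (1 / 10) 40 160) (1 / 20) 10 100000)
    (hP : ChartedChargePricingG (3 / 20) (1 / 10) (3 / 5)) : ChargedEnergyGap :=
  chargedEnergyGap_of_maxCoverBudgetLedger_record hF hIP hFCP hCCP hB hLab hSB (farLabelledFloorCoredBudgetW_of_local hS hN) hP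

/-- The P-C record cone is RECOVERED from the P-D pieces (consistency of the two generations: (H𝄪) ⟹ (Hˢ) and (Nˢ) given). -/
theorem chargedEnergyGap_of_local_via_seam {ϱ : ℝ} (W : CoreWeights (3 / 20) (1 / 10) (6 / 5) 10 (1 / 100) 40 (1 / 10) 40 ϱ)
    (hF : ChargeRecount)
    (hIP : ImprovablePricingG (3 / 20) (1 / 10) (6 / 5) 10 (1 / 100) (3 / 5))
    (hFCP : FrustratedCorePricingG (3 / 20) (1 / 10) (6 / 5) 10 (1 / 100) 40 (3 / 5))
    (hCCP : CoherentCorePricingG (3 / 20) (1 / 10) (6 / 5) 10 (1 / 100) 40 (1 / 10) 40 (3 / 5))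
    (hB : CoreBallRegularPricingW W (1 / 20) (3 / 5) 10 fun _ _ => True)
    (hLab : CleanLabellingW W (3 / 5) 10 (1 / 3) 3)
    (hSB : ShellBudgetW W (3 / 5) 100000)
    (hS : LocalSeamTransferBoundC (3 / 5) (1 / 3) 3 (1 / 100) (3 / 100) (1 / 2) ϱ (2 / 5) 3 (1 / 3000000) 80 (1 / 100000))
    (hN : SeamReductionW (3 / 5) (1 / 3) 3 (1 / 100) (3 / 100) (1 / 2) ϱ (2 / 5) 3 (1 / 3000000) W (1 / 20) 10 100000)
    (hP : ChartedChargePricingG (3 / 20) (1 / 10) (3 / 5)) : ChargedEnergyGap :=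
  chargedEnergyGap_of_seamLedger W hF hIP hFCP hCCP hB hLab hSB (seamTransferBoundC_of_local hS) hN hP

end Record

end Summit.AtomisticToContinuum.Crystallization.Theorems.ChargedEnergyGapChartDial

end

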